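import Summits.QuantumFields.BalabanUV.Beta.GAN24.SubAveragingMinimiser

/-!
# `BalabanUV.Beta.GAN24.SubAveragingMinimiserKernel` — binder row G-an2-4 ∕ (CONV-C), programme «SUBAVG-H», FILE B (kernel level):
# THE SCALAR HARD MINIMISER `H_k = 𝒢Q_k^*(Q_k𝒢Q_k^*)⁻¹` (B5 (1.103), massless, `U = 1`) ON `ℤ^{d+1}` — `n`-UNIFORM STRIP REGULARITY,
# `j`-UNIFORM EXPONENTIAL DECAY OF ITS KERNEL, AND THE SUB-AVERAGED ONE-STEP RATE `θ = L⁻²` WITH THE SAME DECAY (THE END)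

NOT IN PRINT; OUR PROOF ATTEMPT (prover part P3 of row G-an2-4, fibre∕strip («Woodbury») lineage, gen 23; CRUX TEAM (2), ruling «YM
REDIRECT TOWARDS THE SUMMIT», 2026-08-21).  HONEST DEPENDENCY (cell records, verbatim): «continuum YM on T⁴ ⇐ BetaPertH ∧ nine spine
estimates (0/9 proved); BetaPertH ⇐ (D1) ∧ (D4) ∧ CAP+tail; G-an2-4 gates asym, D1 and NE2/3/4.»  HONEST FRAMING (cell contract,
verbatim): «discharging `BetaPertH` makes Bałaban's UV stability UNCONDITIONAL — a real constructive-QFT result; it is NOT the continuum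
limit and NOT the Clay problem.»  ABSOLUTE RULE: nothing printed is a hypothesis.  [folklore] assembly over FILE A (`Hm`, `avgHm`, `DmultH`,
`norm_DmultH_le`), gen 22's `GAN24/SubAveragingKernel` (`stripRegular_avgG`, `stripRegular_finsum`, `Tsub`), `B4StripSums.stripRegular_G`,
`B4StripCauchy.uniformStrip_holds` (the `n`-uniform zero-free strip of `E`), road FP's `CoarseCovarianceSymbol.F_lower` ∕ `stripRegular_invSymbol`
(the `n`-uniform zero-free strip of the HARD denominator `E(1,0) − Δ^ξ`) and the contour-shift engine `B4ContourShift.latticeKernel_decay`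
(strip-regular multiplier ⟹ exponentially decaying lattice kernel).  No `def … : Prop`, no sorry; one [folklore] constant (`CHlog`).

## What is proved (every `d`, every `L ≥ 1`, every `n ≥ 1` — not only powers of `L`)

* §1 `hard_lower` (packaging of `F_lower`), **`stripRegular_Hm`**: on `Strip (d+1) κ` (`κ ≤ rOf`) where `c ≤ |E(1,0)|` and `c_F ≤ |E(1,0) − Δ^ξ|`,
  `StripRegular (Hm n τ) κ (boundG·(1 + 16(d+1)∕c_F))` for every `n`, `τ`; `stripRegular_avgHm`; **`stripRegular_DmultH`** with THE RATE
  `CH(n)∕n²` as its bound.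
* §2 the kernel dictionary `latticeKernel_avgHm` (the kernel of the sub-cell-averaged multiplier IS the sub-cell average of the finer kernels).
* §3 **`minimiser_kernel_decay`** — `∃ κ > 0, M ≥ 0: ∀ n ≥ 1, τ, x ∈ ℤ^{d+1}: ‖latticeKernel (Hm n τ) x‖ ≤ M·e^{−κ|x|_∞}` — the `j`-UNIFORM
  exponential decay of `H_k(y + τ∕n, y′)` in `|y − y′|_∞` (B5 Prop. 1.2 (1.110)-type statement for the scalar hard minimiser on the whole lattice
  by the analyticity method; the tree's `B5Hk103ScalarZd.abs_kerH_le` is the position-space sibling with its own constants);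
  **`subavg_minimiser_rate`** — THE END: `∃ κ, c, c_F > 0: ∀ n ≥ 1, τ ∈ (Fin n)^{d+1}, x ∈ ℤ^{d+1}:
  ‖(L^{d+1})⁻¹ Σ_ρ latticeKernel (Hm (n·L) (Tsub τ ρ)) x − latticeKernel (Hm n τ) x‖ ≤ CH(n)∕n² · e^{−κ|x|_∞}`** — the SUB-CELL AVERAGE of the
  finer minimiser column `(H_{k+1}B)(y + (Lτ+ρ)∕(nL))` minus the coarser `(H_kB)(y + τ∕n)` is `O((log n)^{d+1}n⁻²)` entrywise, with `n`-uniform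
  exponential decay (`n = L^k`: one-step rate `θ = L⁻²` up to `k^{d+1}`); `subavg_minimiser_rate_log` (the `(48(1+log n))^{d+1}` form, constant `CHlog`).

HONEST: the logarithm is the price of the ENTRYWISE currency (alias weight `HF`); FILE C (`SubAveragingMinimiserUnitTower`) removes it in the
unit-read block-mean currency.  NOT the vector `H_k` (1.63), NOT composites, NOT `U ≠ 1`.  NEVER «G-an2-4 closed»; NOT D1, NOT BetaPertH, NOT
continuum, NOT Clay.  Provenance: prover-b2b-balaban-gan24-p3-g23-0 (unit `b2b-balaban-gan24-p3`, gen 23), 2026-08-21.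
-/

noncomputable section

namespace Summit.QuantumFields.BalabanUV.Beta.GAN24.SubAveragingMinimiserKernel

open Complex Finset MeasureTheory
open Literature.MathematicalPhysics.QuantumFieldTheory.Balaban1983to89
open Literature.MathematicalPhysics.QuantumFieldTheory.Balaban1983to89.B4Strip
open Literature.MathematicalPhysics.QuantumFieldTheory.Balaban1983to89.B4StripCauchy
open Literature.MathematicalPhysics.QuantumFieldTheory.Balaban1983to89.B4StripSums
open Literature.MathematicalPhysics.QuantumFieldTheory.Balaban1983to89.B4ContourShift
open Literature.MathematicalPhysics.QuantumFieldTheory.Balaban1983to89.B5Strip145Analytic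
open Summit.QuantumFields.BalabanUV.Beta.GAN24.SubAveragingFibreColumn
open Summit.QuantumFields.BalabanUV.Beta.GAN24.SubAveragingKernel
open Summit.QuantumFields.BalabanUV.Beta.GAN24.SubAveragingMinimiser
open Summit.QuantumFields.BalabanUV.Beta.FP
open scoped Real

variable {d : ℕ}

/-! ## §1 Strip regularity of the hard column, of its sub-cell average, and of the difference (with the rate) -/

/-- [folklore] THE `n`-UNIFORM ZERO-FREE STRIP OF THE HARD DENOMINATOR, packaged: `∃ κ_F ≤ rOf, c_F > 0` with `c_F ≤ |E n 1 0 p − Δ^ξ_n(p)|`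
on `Strip d κ_F` for EVERY `n ≥ 1` (road FP leaf-06's `CoarseCovarianceSymbol.F_lower`, `d`-only constants). -/
theorem hard_lower (d : ℕ) : ∃ κF cF : ℝ, 0 < κF ∧ κF ≤ rOf d ∧ 0 < cF ∧
    ∀ (n : ℕ) [NeZero n], ∀ p ∈ Strip d κF, cF ≤ ‖E n 1 0 p - DeltaXi n 0 p‖ := by
  obtain ⟨hκ, h⟩ := CoarseCovarianceSymbol.F_lower d
  exact ⟨_, _, hκ, min_le_left _ _, by positivity, fun n _ => h n⟩

/-- [folklore] **THE COMMON `n`-UNIFORM STRIP OF BOTH DENOMINATORS**, packaged once for all consumers: `∃ κ ≤ rOf d, c, c_F > 0` such that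
for EVERY `n ≥ 1` and every `p ∈ Strip d κ`: `c ≤ |E n 1 0 p|` (B4's soft denominator at `a = 1`, `m² = 0`; `B4StripCauchy.uniformStrip_holds`)
and `c_F ≤ |E n 1 0 p − Δ^ξ_n(p)|` (the hard denominator; `hard_lower`). -/
theorem strip_data (d : ℕ) : ∃ κ c cF : ℝ, 0 < κ ∧ κ ≤ rOf d ∧ 0 < c ∧ 0 < cF ∧ ∀ (n : ℕ) [NeZero n],
    (∀ p ∈ Strip d κ, c ≤ ‖E n 1 0 p‖) ∧ (∀ p ∈ Strip d κ, cF ≤ ‖E n 1 0 p - DeltaXi n 0 p‖) := by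
  obtain ⟨κ₁, c, hκ₁, hc, h⟩ := uniformStrip_holds d 1 1 0 one_pos
  obtain ⟨κF, cF, hκF, hκFr, hcF, hF⟩ := hard_lower d
  refine ⟨min κ₁ κF, c, cF, lt_min hκ₁ hκF, (min_le_right _ _).trans hκFr, hc, hcF, fun n _ => ⟨?_, ?_⟩⟩
  · exact fun p hp => h n 1 0 le_rfl le_rfl le_rfl le_rfl p (strip_mono (min_le_left _ _) hp)
  · exact fun p hp => hF n p (strip_mono (min_le_right _ _) hp)

/-- [folklore] the effective-Laplacian symbol is strip regular, `n`-uniformly (leaf-06's `stripRegular_invSymbol` by name). -/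
theorem stripRegular_Leff (n : ℕ) [NeZero n] {κ cF : ℝ} (hκ0 : 0 ≤ κ) (hκr : κ ≤ rOf (d + 1)) (hcF : 0 < cF)
    (hF : ∀ p ∈ Strip (d + 1) κ, cF ≤ ‖E n 1 0 p - DeltaXi n 0 p‖) :
    StripRegular (d := d) (Leff n) κ (16 * (d + 1) / cF) :=
  CoarseCovarianceSymbol.stripRegular_invSymbol n hκ0 hκr hcF hF

/-- [folklore] **THE HARD MINIMISER COLUMN IS STRIP REGULAR, `n`-UNIFORMLY**: on `Strip (d+1) κ` (`0 ≤ κ ≤ rOf (d+1)`) where `c ≤ |E n 1 0|`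
and `c_F ≤ |E n 1 0 − Δ^ξ_n|`, `Hm n τ` is `StripRegular` with bound `boundG (d+1) c 0 · (1 + 16(d+1)∕c_F)`, for every `n ≥ 1` and `τ`. -/
theorem stripRegular_Hm (n : ℕ) [NeZero n] (τ : Fin (d + 1) → Fin n) {κ c cF : ℝ} (hκ0 : 0 ≤ κ) (hκr : κ ≤ rOf (d + 1))
    (hc : 0 < c) (hcF : 0 < cF) (hE : ∀ p ∈ Strip (d + 1) κ, c ≤ ‖E n 1 0 p‖)
    (hF : ∀ p ∈ Strip (d + 1) κ, cF ≤ ‖E n 1 0 p - DeltaXi n 0 p‖) :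
    StripRegular (d := d) (Hm n τ) κ (boundG (d + 1) c 0 * (1 + 16 * (d + 1) / cF)) := by
  have h1 := stripRegular_G n 1 0 0 le_rfl le_rfl τ hκ0 hκr hc hE
  have h2 := (stripRegular_const (1 : ℂ) κ).add (stripRegular_Leff n hκ0 hκr hcF hF)
  have h3 := h1.mul h2 (boundG_nonneg (d + 1) hc le_rfl)
  rw [norm_one] at h3
  exact h3

/-- [folklore] the sub-cell average of the finer hard column is strip regular (bound irrelevant: only the fields are used). -/
theorem stripRegular_avgHm (n L : ℕ) [NeZero n] [NeZero L] (τ : Fin (d + 1) → Fin n) {κ c cF : ℝ} (hκ0 : 0 ≤ κ)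
    (hκr : κ ≤ rOf (d + 1)) (hc : 0 < c) (hcF : 0 < cF) (hE' : ∀ p ∈ Strip (d + 1) κ, c ≤ ‖E (n * L) 1 0 p‖)
    (hF' : ∀ p ∈ Strip (d + 1) κ, cF ≤ ‖E (n * L) 1 0 p - DeltaXi (n * L) 0 p‖) :
    StripRegular (d := d) (avgHm n L τ) κ
      ((‖((L : ℂ) ^ (d + 1))⁻¹‖ * ∑ _ρ : Fin (d + 1) → Fin L, boundG (d + 1) c 0) * (1 + 16 * (d + 1) / cF)) := by
  have h1 := stripRegular_avgG n L 1 0 0 le_rfl le_rfl τ hκ0 hκr hc hE'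
  have h2 := (stripRegular_const (1 : ℂ) κ).add (stripRegular_Leff (n * L) hκ0 hκr hcF hF')
  have h0 : 0 ≤ ‖((L : ℂ) ^ (d + 1))⁻¹‖ * ∑ _ρ : Fin (d + 1) → Fin L, boundG (d + 1) c 0 :=
    mul_nonneg (norm_nonneg _) (Finset.sum_nonneg fun _ _ => boundG_nonneg (d + 1) hc le_rfl)
  have h3 := h1.mul h2 h0
  rw [norm_one] at h3
  have e : (fun p => avgG n L 1 0 τ p * (1 + Leff (n * L) p)) = avgHm n L τ := by
    funext p; rw [avgHm_eq]
  rw [e] at h3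
  exact h3

/-- [folklore] **THE DIFFERENCE MULTIPLIER IS STRIP REGULAR WITH THE RATE BOUND**: on `Strip (d+1) κ` (`0 ≤ κ ≤ rOf (d+1)`) where both soft
denominators are `≥ c` and both hard denominators are `≥ c_F` in modulus, `DmultH n L τ` is `StripRegular` with bound `CH(n)∕n²`. -/
theorem stripRegular_DmultH (n L : ℕ) [NeZero n] [NeZero L] (τ : Fin (d + 1) → Fin n) {κ c cF : ℝ} (hκ0 : 0 ≤ κ)
    (hκr : κ ≤ rOf (d + 1)) (hc : 0 < c) (hcF : 0 < cF)
    (hE : ∀ p ∈ Strip (d + 1) κ, c ≤ ‖E n 1 0 p‖) (hE' : ∀ p ∈ Strip (d + 1) κ, c ≤ ‖E (n * L) 1 0 p‖)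
    (hF : ∀ p ∈ Strip (d + 1) κ, cF ≤ ‖E n 1 0 p - DeltaXi n 0 p‖)
    (hF' : ∀ p ∈ Strip (d + 1) κ, cF ≤ ‖E (n * L) 1 0 p - DeltaXi (n * L) 0 p‖) :
    StripRegular (d := d) (DmultH n L τ) κ (CH n (d + 1) L c cF / (n : ℝ) ^ 2) := by
  have h1 := stripRegular_avgHm n L τ hκ0 hκr hc hcF hE' hF'
  have h2 := stripRegular_Hm n τ hκ0 hκr hc hcF hE hF
  have h3 := (stripRegular_const (-1 : ℂ) κ).mul h2 (norm_nonneg _)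
  have h4 := h1.add h3
  have e : (fun p => avgHm n L τ p + (-1) * Hm n τ p) = DmultH n L τ := by
    funext p; unfold DmultH; ring
  rw [e] at h4
  have hr4 : rOf (d + 1) ≤ 1 / 4 := rOf_le (d + 1)
  have hdr : ((d + 1 : ℕ) : ℝ) * rOf (d + 1) ^ 2 ≤ 1 / 16 := by
    have h := d_mul_rOf_sq_le (d + 1)
    exact_mod_cast h
  have hd : 0 < d + 1 := Nat.succ_pos d
  refine ⟨h4.cont, h4.diff, h4.sides, fun p hp => ?_⟩
  have hpF : p ∈ Fat (d + 1) (rOf (d + 1)) := strip_subset_fat (le_of_lt (rOf_pos (d + 1))) hκr hp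
  have h := norm_DmultH_le n L hd hr4 (by exact_mod_cast hdr) hpF hc hcF (hE p hp) (hE' p hp) (hF p hp) (hF' p hp) τ
  exact_mod_cast h

/-! ## §2 The kernel dictionary -/

/-- [folklore] the integrand of `avgHm` is the scaled sum of the integrands of the finer multipliers (pointwise). -/
theorem integrand_avgHm (n L : ℕ) [NeZero n] [NeZero L] (τ : Fin d → Fin n) (x : Fin d → ℤ) (q : Fin d → ℝ) :
    integrand (avgHm n L τ) x q = ((L : ℂ) ^ d)⁻¹ * ∑ ρ : Fin d → Fin L, integrand (Hm (n * L) (Tsub n L τ ρ)) x q := by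
  unfold integrand avgHm
  rw [mul_assoc, Finset.sum_mul]

/-- [folklore] **THE KERNEL DICTIONARY**: `latticeKernel (avgHm τ) x = (L^{d+1})⁻¹ Σ_ρ latticeKernel (Hm (n·L) (Tsub τ ρ)) x` (linearity of
the Brillouin-zone integral; integrability from the strip regularity of the finer columns). -/
theorem latticeKernel_avgHm (n L : ℕ) [NeZero n] [NeZero L] (τ : Fin (d + 1) → Fin n) {κ c cF : ℝ} (hκ0 : 0 ≤ κ)
    (hκr : κ ≤ rOf (d + 1)) (hc : 0 < c) (hcF : 0 < cF) (hE' : ∀ p ∈ Strip (d + 1) κ, c ≤ ‖E (n * L) 1 0 p‖)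
    (hF' : ∀ p ∈ Strip (d + 1) κ, cF ≤ ‖E (n * L) 1 0 p - DeltaXi (n * L) 0 p‖) (x : Fin (d + 1) → ℤ) :
    latticeKernel (avgHm n L τ) x
      = ((L : ℂ) ^ (d + 1))⁻¹ * ∑ ρ : Fin (d + 1) → Fin L, latticeKernel (Hm (n * L) (Tsub n L τ ρ)) x := by
  have hint : ∀ ρ : Fin (d + 1) → Fin L, IntegrableOn (integrand (Hm (n * L) (Tsub n L τ ρ)) x) (BZ (d + 1)) := fun ρ =>
    (stripRegular_Hm (n * L) (Tsub n L τ ρ) hκ0 hκr hc hcF hE' hF').integrableOn hκ0 x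
  unfold latticeKernel fourierBox
  have e : (fun q => integrand (avgHm n L τ) x q)
      = fun q => ((L : ℂ) ^ (d + 1))⁻¹ * ∑ ρ : Fin (d + 1) → Fin L, integrand (Hm (n * L) (Tsub n L τ ρ)) x q := by
    funext q; exact integrand_avgHm n L τ x q
  rw [show (∫ q in BZ (d + 1), integrand (avgHm n L τ) x q)
      = ∫ q in BZ (d + 1), ((L : ℂ) ^ (d + 1))⁻¹ * ∑ ρ : Fin (d + 1) → Fin L, integrand (Hm (n * L) (Tsub n L τ ρ)) x q
      from by rw [e]]
  rw [integral_const_mul, integral_finsetSum _ (fun ρ _ => hint ρ)]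
  simp only [Complex.real_smul]
  rw [Finset.mul_sum, Finset.mul_sum, Finset.mul_sum]
  exact Finset.sum_congr rfl fun ρ _ => by ring

/-- [folklore] **THE KERNEL OF THE DIFFERENCE MULTIPLIER IS THE ONE-STEP KERNEL DIFFERENCE**:
`latticeKernel (DmultH τ) x = (L^{d+1})⁻¹ Σ_ρ latticeKernel (Hm (n·L) (Tsub τ ρ)) x − latticeKernel (Hm n τ) x`. -/
theorem latticeKernel_DmultH (n L : ℕ) [NeZero n] [NeZero L] (τ : Fin (d + 1) → Fin n) {κ c cF : ℝ} (hκ0 : 0 ≤ κ)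
    (hκr : κ ≤ rOf (d + 1)) (hc : 0 < c) (hcF : 0 < cF)
    (hE : ∀ p ∈ Strip (d + 1) κ, c ≤ ‖E n 1 0 p‖) (hE' : ∀ p ∈ Strip (d + 1) κ, c ≤ ‖E (n * L) 1 0 p‖)
    (hF : ∀ p ∈ Strip (d + 1) κ, cF ≤ ‖E n 1 0 p - DeltaXi n 0 p‖)
    (hF' : ∀ p ∈ Strip (d + 1) κ, cF ≤ ‖E (n * L) 1 0 p - DeltaXi (n * L) 0 p‖) (x : Fin (d + 1) → ℤ) :
    latticeKernel (DmultH n L τ) x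
      = ((L : ℂ) ^ (d + 1))⁻¹ * ∑ ρ : Fin (d + 1) → Fin L, latticeKernel (Hm (n * L) (Tsub n L τ ρ)) x
        - latticeKernel (Hm n τ) x := by
  rw [← latticeKernel_avgHm n L τ hκ0 hκr hc hcF hE' hF' x]
  have hint1 := (stripRegular_avgHm n L τ hκ0 hκr hc hcF hE' hF').integrableOn hκ0 x
  have hint2 := (stripRegular_Hm n τ hκ0 hκr hc hcF hE hF).integrableOn hκ0 x
  unfold latticeKernel fourierBox
  rw [← smul_sub, ← integral_sub hint1 hint2]
  congr 1
  refine setIntegral_congr_fun (by unfold BZ; exact measurableSet_Icc) fun q _ => ?_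
  simp only [integrand, DmultH]
  ring

/-! ## §3 The `j`-uniform decay of the minimiser kernel, and THE END -/

/-- [folklore] **THE `j`-UNIFORM EXPONENTIAL DECAY OF THE SCALAR HARD MINIMISER KERNEL ON THE WHOLE LATTICE.**  There are `κ > 0` and
`M ≥ 0` (functions of `d` alone) such that for EVERY `n ≥ 1`, every fine offset `τ ∈ (Fin n)^{d+1}` and every `x ∈ ℤ^{d+1}`:
`‖latticeKernel (Hm n τ) x‖ ≤ M·e^{−κ|x|_∞}` — `|H_k(y + τ∕n, y′)| ≤ M e^{−κ|y−y′|_∞}` uniformly in `k` (`n = L^k`). -/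
theorem minimiser_kernel_decay (d : ℕ) : ∃ κ M : ℝ, 0 < κ ∧ 0 ≤ M ∧ ∀ (n : ℕ) [NeZero n]
    (τ : Fin (d + 1) → Fin n) (x : Fin (d + 1) → ℤ), ‖latticeKernel (Hm n τ) x‖ ≤ M * Real.exp (-(κ * supNorm x)) := by
  obtain ⟨κ, c, cF, hκ, hκr, hc, hcF, h⟩ := strip_data (d + 1)
  refine ⟨κ, boundG (d + 1) c 0 * (1 + 16 * (d + 1) / cF), hκ,
    mul_nonneg (boundG_nonneg (d + 1) hc le_rfl) (by positivity), ?_⟩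
  intro n _ τ x
  obtain ⟨hE, hF⟩ := h n
  exact latticeKernel_decay (stripRegular_Hm n τ hκ.le hκr hc hcF hE hF) hκ.le x

/-- [folklore] **THE END — THE SUB-AVERAGED ONE-STEP RATE WITH EXPONENTIAL DECAY FOR THE SCALAR HARD MINIMISER `H_k` AT `U = 1`.**  For every
`L ≥ 1` there are `κ > 0`, `c > 0`, `c_F > 0` (functions of `d` alone) such that for EVERY `n ≥ 1`, every coarse fine site `τ ∈ (Fin n)^{d+1}`
and every `x ∈ ℤ^{d+1}`:
`‖(L^{d+1})⁻¹ Σ_ρ latticeKernel (Hm (n·L) (Tsub τ ρ)) x − latticeKernel (Hm n τ) x‖ ≤ CH(n, d+1, L, c, c_F)∕n² · e^{−κ|x|_∞}`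
— the sub-cell average of the finer minimiser column `(H_{k+1}B)(y + (Lτ+ρ)∕(nL), ·)` minus the coarser `(H_kB)(y + τ∕n, ·)` is
`O((log n)^{d+1} n⁻²)` uniformly, with `n`-uniform exponential decay in `|y − y′|_∞` (`n = L^k`: rate `θ = L⁻²` up to `k^{d+1}`). -/
theorem subavg_minimiser_rate (d : ℕ) (L : ℕ) [NeZero L] :
    ∃ κ c cF : ℝ, 0 < κ ∧ 0 < c ∧ 0 < cF ∧ ∀ (n : ℕ) [NeZero n] (τ : Fin (d + 1) → Fin n) (x : Fin (d + 1) → ℤ),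
      ‖((L : ℂ) ^ (d + 1))⁻¹ * ∑ ρ : Fin (d + 1) → Fin L, latticeKernel (Hm (n * L) (Tsub n L τ ρ)) x
          - latticeKernel (Hm n τ) x‖
        ≤ CH n (d + 1) L c cF / (n : ℝ) ^ 2 * Real.exp (-(κ * supNorm x)) := by
  obtain ⟨κ, c, cF, hκ, hκr, hc, hcF, h⟩ := strip_data (d + 1)
  refine ⟨κ, c, cF, hκ, hc, hcF, ?_⟩
  intro n _ τ x
  obtain ⟨hE, hF⟩ := h n
  obtain ⟨hE', hF'⟩ := h (n * L)
  have hreg := stripRegular_DmultH n L τ hκ.le hκr hc hcF hE hE' hF hF'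
  rw [← latticeKernel_DmultH n L τ hκ.le hκr hc hcF hE hE' hF hF' x]
  exact latticeKernel_decay hreg hκ.le x

/-- [folklore] the constant of the logarithmic form: `CH` with the alias weight `HF(n)` replaced by `(48(1+log n))^d`. -/
def CHlog (n : ℕ) (d L : ℕ) (c cF : ℝ) : ℝ :=
  (48 * (1 + Real.log n)) ^ d * Ccol d L 1 0 c * (1 + 16 * (d : ℝ) / cF) + boundG d c 0 * CL d L cF

/-- [folklore] `CH n ≤ CHlog n` (`HF_le_log`). -/
theorem CH_le_CHlog (n d L : ℕ) {c cF : ℝ} (hc : 0 < c) (hcF : 0 < cF) : CH n d L c cF ≤ CHlog n d L c cF := by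
  unfold CH CHlog
  have h1 := HF_le_log n d
  have h2 : 0 ≤ Ccol d L 1 0 c * (1 + 16 * (d : ℝ) / cF) :=
    mul_nonneg (Ccol_nonneg d L zero_le_one le_rfl hc) (by positivity)
  nlinarith [mul_le_mul_of_nonneg_right h1 h2]

/-- [folklore] **THE END, LOGARITHMIC FORM**: same `κ, c, c_F`, bound `CHlog(n)∕n² · e^{−κ|x|_∞}` with
`CHlog(n) = (48(1+log n))^{d+1}·Ccol·(1 + 16(d+1)∕c_F) + boundG·CL` — with `n = L^k` this is `≤ C(d,L)·(1 + k log L)^{d+1}·L^{−2k}·e^{−κ|x|_∞}`: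
the SHARP one-step exponent `θ = L⁻²` up to the logarithm of the entrywise currency. -/
theorem subavg_minimiser_rate_log (d : ℕ) (L : ℕ) [NeZero L] :
    ∃ κ c cF : ℝ, 0 < κ ∧ 0 < c ∧ 0 < cF ∧ ∀ (n : ℕ) [NeZero n] (τ : Fin (d + 1) → Fin n) (x : Fin (d + 1) → ℤ),
      ‖((L : ℂ) ^ (d + 1))⁻¹ * ∑ ρ : Fin (d + 1) → Fin L, latticeKernel (Hm (n * L) (Tsub n L τ ρ)) x
          - latticeKernel (Hm n τ) x‖
        ≤ CHlog n (d + 1) L c cF / (n : ℝ) ^ 2 * Real.exp (-(κ * supNorm x)) := by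
  obtain ⟨κ, c, cF, hκ, hc, hcF, h⟩ := subavg_minimiser_rate d L
  refine ⟨κ, c, cF, hκ, hc, hcF, ?_⟩
  intro n _ τ x
  refine (h n τ x).trans ?_
  have h1 := CH_le_CHlog n (d + 1) L hc hcF
  have hexp : 0 ≤ Real.exp (-(κ * supNorm x)) := (Real.exp_pos _).le
  have hn2 : (0 : ℝ) ≤ (n : ℝ) ^ 2 := sq_nonneg _
  gcongr

end Summit.QuantumFields.BalabanUV.Beta.GAN24.SubAveragingMinimiserKernel
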